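import Summits.RiemannHypothesis.RiemannHypothesis.Theorems.HandoffDodgerWitness
import HarnessLib

/-!
# HANDOFF — the GAIN with a FREE COLLAR WINDOW `[αY, (1−α)Y]` and the dodger witness on it (rh-explicit, W-P(P2) crux 19185, seat dodger-p2 gen0; ATTEMPT-23 §7 (a) «window lever»)

RH-FREE. HONEST FRAMING: nothing here bears on the truth of RH; this is the elementary collar lower bound of gen10's
`HandoffDodgerWitness.dodger_collar_ge` with ONE hard-coded choice freed. gen10 restricts the collar integral
`∫₀^{Y} m(σ)m(Y−σ)dσ` (`Y = 2δ − 4ε`, `m(σ) = κ·(c_∞/2b)·Φ(p₁σ²)` the monotone profile minorant of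
`HandoffDodgerProfileControl.re_dodger_edge_sub_ge`) to the middle quarter `[3Y/8, 5Y/8]`, getting `(Y/4)·m(3Y/8)²`. Since
`log Φ(x) ≈ 3(x/4)^{1/3}` is steep, a window `[αY, (1−α)Y]` with `α` close to `1/2` is much better:
`(1−2α)·Y·m(αY)²` (`dodger_collar_ge_window`, any `0 ≤ α ≤ 1/2`). The rest is gen10's witness verbatim with the new gain bound
written out in the comparison `hlt` of `dodger_witness_window`; `HandoffDodgerExplicitWindow` eliminates the non-explicit
quantities as in `HandoffDodgerExplicitSharp`. MODEL (this seat's code/model3.py = gen11's audit with the new gain): at the optimal `α ≈ 0.48` the floor of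
the explicit chain moves from `q ≈ 10⁴` (sharp, `α = 3/8`) to `q ≈ 7·10³`. No `sorry`, standard axioms, no definitions.

References: this track (ATTEMPT-16 §5 Lemma D2/D3; ATTEMPT-19 §6–§7; ATTEMPT-23 §7).
-/

set_option linter.dupNamespace false

noncomputable section

open Complex Finset MeasureTheory Set

namespace Summit.RiemannHypothesis.RiemannHypothesis.Theorems.Handoff

open Literature.NumberTheory.LFunctions Literature.NumberTheory.LFunctions.SchoenfeldBound Literature.NumberTheory.LFunctions.WeilContinuous
open scoped Real

/-! ## The collar gain on a free window -/

/-- **ATTEMPT-16 Lemma D2/D3 with a free window.** Under the hypotheses of `dodger_collar_ge` and `0 ≤ α ≤ 1/2`, with `Y = 2δ − 4ε`: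
`(1−2α)·Y·(κ·(c_∞/2b)·Φ(p₁(αY)²))² ≤ Re (θ ⋆ θ̃)(2(b+ε) − 2δ)` (on `[αY, (1−α)Y]` both profile factors are `≥ m(αY)`).
[this track, ATTEMPT-16 §5; ATTEMPT-19 §6; ATTEMPT-23 §7] -/
theorem dodger_collar_ge_window {b T δ α : ℝ} (n : ℕ) (hα0 : 0 ≤ α) (hα : α ≤ 1 / 2) (hb : 0 < b) (hT : 0 ≤ T) (hK : π * (zetaZeroCount T) / b ≤ T)
    (hΔ : ∀ t ∈ Set.Icc 0 T, (zetaZeroCount t : ℝ) - ((min ⌊b * t / π⌋₊ (zetaZeroCount T) : ℕ) : ℝ) ≤ 0)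
    (hp : 0 < (dodgerPowerSum b T 1).re) (hδb : δ ≤ b) (hεδ : 2 * (bump n).rOut ≤ δ)
    {N₁ N₂ : ℕ} (hN : N₁ ≤ N₂) (hWN : (T ^ 2 + 1 / 4) * N₂ ≤ (dodgerPowerSum b T 1).re / 2)
    {X η lam ρ₁ ρ₂ τ₁ τ₂ : ℝ} (hX : (dodgerPowerSum b T 1).re * (2 * δ) ^ 2 ≤ X)
    (hη : Real.exp (2 * ((dodgerPowerSum b T 1).re + (zetaZeroCount T : ℝ) * (T + 1 / 2)) * (T ^ 2 + 1 / 4) * (N₁ : ℝ) ^ 2 /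
        (dodgerPowerSum b T 1).re ^ 2) - 1 ≤ η)
    (hlam : 2 * ((dodgerPowerSum b T 1).re + (zetaZeroCount T : ℝ) * (T + 1 / 2)) * (T ^ 2 + 1 / 4) * (N₂ : ℝ) /
        (dodgerPowerSum b T 1).re ^ 2 ≤ lam)
    (hρ₁ : Real.exp (3 + lam) * X / (4 * ((N₁ : ℝ) + 1) ^ 3) ≤ ρ₁) (hρ₁1 : ρ₁ < 1)
    (hρ₂ : Real.exp 2 * (T ^ 2 + 1 / 4) * (2 * δ) ^ 2 / (2 * ((N₂ : ℝ) + 1) ^ 2) ≤ ρ₂) (hρ₂1 : ρ₂ < 1)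
    (hτ₁ : ρ₁ ^ (N₁ + 1) / (1 - ρ₁) ≤ τ₁)
    (hτ₂ : Real.exp (((dodgerPowerSum b T 1).re + ((dodgerPowerSum b T 1).re + (zetaZeroCount T : ℝ) * (T + 1 / 2))) /
        (2 * (T ^ 2 + 1 / 4))) * ρ₂ ^ (N₂ + 1) / (1 - ρ₂) ≤ τ₂)
    (hκ : 0 ≤ 1 - η - 3 * τ₁ - τ₂) :
    (1 - 2 * α) * (2 * δ - 4 * (bump n).rOut) *
        ((1 - η - 3 * τ₁ - τ₂) *
          ((1 / (2 * b)) * ((∏ k ∈ Finset.range (zetaZeroCount T), (latticeFreq b (k + 1)) ^ 2) /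
            ∏ ρ ∈ zerosBetween 0 T, ‖dodgerNode ρ‖ ^ (2 * (riemannZetaZeroOrder ρ).toNat))) *
          dodgerPhi ((dodgerPowerSum b T 1).re * (α * (2 * δ - 4 * (bump n).rOut)) ^ 2)) ^ 2 ≤
      (weilConv (weilConv (cutoffCosPoly b (zetaZeroCount T) (dodgerCoeff b T (zetaZeroCount T))) (moll n))
        (weilReflect (weilConv (cutoffCosPoly b (zetaZeroCount T) (dodgerCoeff b T (zetaZeroCount T))) (moll n)))
        (2 * (b + (bump n).rOut) - 2 * δ)).re := by
  -- names
  set ε := (bump n).rOut with hεdef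
  set F₀ := cutoffCosPoly b (zetaZeroCount T) (dodgerCoeff b T (zetaZeroCount T)) with hF₀
  set φ := moll n with hφdef
  set θ := weilConv F₀ φ with hθdef
  set p := (dodgerPowerSum b T 1).re with hpdef
  set cR := (∏ k ∈ Finset.range (zetaZeroCount T), (latticeFreq b (k + 1)) ^ 2) /
      ∏ ρ ∈ zerosBetween 0 T, ‖dodgerNode ρ‖ ^ (2 * (riemannZetaZeroOrder ρ).toNat) with hcR
  set κ' := (1 - η - 3 * τ₁ - τ₂) * (1 / (2 * b) * cR) with hκ'
  set m : ℝ → ℝ := fun σ => κ' * dodgerPhi (p * σ ^ 2) with hm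
  set Y := 2 * δ - 4 * ε with hY
  set A := b + ε with hA
  have hε0 : 0 < ε := by rw [hεdef, bump_rOut]; positivity
  have hY0 : 0 ≤ Y := by rw [hY]; linarith
  have hδ0 : 0 ≤ δ := by linarith
  have hcR0 : 0 < cR := by
    have h1 : 0 < ∏ k ∈ Finset.range (zetaZeroCount T), (latticeFreq b (k + 1)) ^ 2 :=
      Finset.prod_pos fun k _ => by unfold latticeFreq; positivity
    exact div_pos h1 (prod_norm_dodgerNode_pow_pos T)
  have hκ'0 : 0 ≤ κ' := mul_nonneg hκ (by positivity)
  have hm0 : ∀ σ, 0 ≤ m σ := fun σ => mul_nonneg hκ'0 (dodgerPhi_pos (by positivity)).le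
  have hmmono : ∀ {x y : ℝ}, 0 ≤ x → x ≤ y → m x ≤ m y := by
    intro x y hx hxy
    simp only [hm]
    refine mul_le_mul_of_nonneg_left (dodgerPhi_le_dodgerPhi (by positivity) ?_) hκ'0
    exact mul_le_mul_of_nonneg_left (pow_le_pow_left₀ hx hxy 2) hp.le
  -- `F₀`
  have hFi : Integrable F₀ := integrable_cutoffCosPoly b _ _
  have hFsupp : ∀ u : ℝ, b < |u| → F₀ u = 0 := fun u hu => cutoffCosPoly_eq_zero_of_lt hu
  have hFs : HasCompactSupport F₀ :=
    HasCompactSupport.of_support_subset_isCompact (isCompact_Icc (a := -b) (b := b)) fun t ht => by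
      have h : |t| ≤ b := le_of_not_gt fun h' => (Function.mem_support.1 ht) (hFsupp t h')
      exact Set.mem_Icc.2 (abs_le.1 h)
  have hFreal : ∀ u : ℝ, (F₀ u).im = 0 := fun u => im_cutoffCosPoly b _ _ u
  have hFeven : ∀ u : ℝ, F₀ (-u) = F₀ u := fun u => cutoffCosPoly_neg b _ _ u
  have hFb : ∀ x : ℝ, b < x → F₀ x = 0 := fun x hx => hFsupp x (hx.trans_le (le_abs_self x))
  -- `φ`
  have hφtest : IsWeilTest φ := isWeilTest_moll n
  have hφreal : ∀ v : ℝ, (φ v).im = 0 := fun v => im_moll n v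
  have hφ0 : ∀ v : ℝ, 0 ≤ (φ v).re := fun v => by
    obtain ⟨r, hr, e⟩ := moll_eq_ofReal_nonneg n v
    rw [hφdef, e, Complex.ofReal_re]; exact hr
  have hφsupp : ∀ v : ℝ, ε < |v| → φ v = 0 := fun v hv => moll_eq_zero hv.le
  have hφmass : ∫ v, φ v = 1 := integral_moll n
  have hφi : Integrable φ := hφtest.1.continuous.integrable_of_hasCompactSupport hφtest.2
  have hφeven : ∀ v : ℝ, φ (-v) = φ v := fun v => by
    show moll n (-v) = moll n v
    unfold moll
    rw [ContDiffBump.normed_neg]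
  obtain ⟨Cφ, hCφ⟩ := hφtest.1.continuous.bounded_above_of_compact_support hφtest.2
  have hint : ∀ x : ℝ, Integrable fun u : ℝ => F₀ u * φ (x - u) := fun x =>
    hFi.mul_bdd ((hφtest.1.continuous.comp (continuous_const.sub continuous_id)).aestronglyMeasurable)
      (Filter.Eventually.of_forall fun u => hCφ _)
  -- `θ`
  have hθ : IsWeilTest θ := isWeilTest_weilConv_of_locallyIntegrable hFi.locallyIntegrable hFs hφtest
  have hθreal : ∀ u : ℝ, (θ u).im = 0 := fun u => im_weilConv_of_im_eq_zero hFreal hφreal u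
  have hθeven : ∀ u : ℝ, θ (-u) = θ u := fun u => weilConv_neg_of_even hFeven hφeven u
  have hθsupp : ∀ u : ℝ, A < |u| → θ u = 0 := fun u hu => weilConv_eq_zero_of_support hFsupp hφsupp hu
  -- the profile minorant on `[0, 2δ]` (ATTEMPT-16 Lemma D1)
  have hFm : ∀ σ ∈ Icc 0 (2 * δ), m σ ≤ (F₀ (b - σ)).re := fun σ hσ =>
    re_dodger_edge_sub_ge hb hT hK hΔ hp hδb hN hWN hX hη hlam hρ₁ hρ₁1 hρ₂ hρ₂1 hτ₁ hτ₂ hσ.1 hσ.2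
  have hF0 : ∀ σ ∈ Icc 0 (2 * δ), 0 ≤ (F₀ (b - σ)).re := fun σ hσ => (hm0 σ).trans (hFm σ hσ)
  have hmono : MonotoneOn m (Icc 0 (2 * δ)) := fun x hx y _ hxy => hmmono hx.1 hxy
  -- the edge minorant `g` of `θ`
  set g : ℝ → ℝ := (Set.Ici (2 * ε)).indicator fun σ => m (σ - 2 * ε) with hg
  have hg0 : ∀ σ ∈ Icc 0 (2 * δ), 0 ≤ g σ := by
    intro σ _
    simp only [hg]
    by_cases h : σ ∈ Set.Ici (2 * ε)
    · rw [indicator_of_mem h]; exact hm0 _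
    · rw [indicator_of_notMem h]
  have hgle : ∀ σ ∈ Icc 0 (2 * δ), g σ ≤ (θ (A - σ)).re := by
    intro σ hσ
    simp only [hg]
    have ex : A - σ = b + ε - σ := by rw [hA]
    by_cases h : σ ∈ Set.Ici (2 * ε)
    · rw [indicator_of_mem h, ex]
      exact re_weilConv_ge_of_profile hFreal hmono hFm hφreal hφ0 hε0.le hφsupp hφmass hφi (Set.mem_Ici.1 h) hσ.2
        (hint _)
    · rw [indicator_of_notMem h, ex]
      exact re_weilConv_nonneg_of_profile hFreal hFb hF0 hφreal hφ0 hφsupp hσ.2 (hint _)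
  -- integrability of the collar minorant on `[A − 2δ, A]`
  have hgm : Measurable g := by
    simp only [hg]
    refine Measurable.indicator ?_ measurableSet_Ici
    exact (continuous_const.mul (continuous_dodgerPhi.comp (continuous_const.mul ((continuous_id.sub continuous_const).pow 2)))).measurable
  have hgbound : ∀ s ∈ Icc 0 (2 * δ), g s ≤ m (2 * δ) := by
    intro s hs
    simp only [hg]
    by_cases h : s ∈ Set.Ici (2 * ε)
    · rw [indicator_of_mem h]
      have h' := Set.mem_Ici.1 h
      exact hmmono (by linarith) (by linarith [hs.2])
    · rw [indicator_of_notMem h]; exact hm0 _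
  have hgi : IntegrableOn (fun u : ℝ => g (A - u) * g (u - (A - 2 * δ))) (Icc (A - 2 * δ) A) := by
    refine IntegrableOn.of_bound (by rw [Real.volume_Icc]; exact ENNReal.ofReal_lt_top)
      (((hgm.comp (measurable_const.sub measurable_id)).mul
        (hgm.comp (measurable_id.sub measurable_const))).aestronglyMeasurable) (m (2 * δ) * m (2 * δ)) ?_
    rw [ae_restrict_iff' measurableSet_Icc]
    refine Filter.Eventually.of_forall fun u hu => ?_
    have h1 : A - u ∈ Icc 0 (2 * δ) := ⟨by linarith [hu.2], by linarith [hu.1]⟩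
    have h2 : u - (A - 2 * δ) ∈ Icc 0 (2 * δ) := ⟨by linarith [hu.1], by linarith [hu.2]⟩
    rw [Real.norm_eq_abs, abs_mul, abs_of_nonneg (hg0 _ h1), abs_of_nonneg (hg0 _ h2)]
    exact mul_le_mul (hgbound _ h1) (hgbound _ h2) (hg0 _ h2) (hm0 _)
  -- the collar lemma
  have hcollar := collar_ge_of_edge_profile hθ hθreal hθeven hθsupp hg0 hgle hgi
  -- restrict the collar integral to the window `[αY, (1−α)Y]`, where both factors are `≥ m(αY)`
  have hαY : α * Y ≤ (1 - α) * Y := by nlinarith only [hα, hY0]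
  have hαY0 : 0 ≤ α * Y := mul_nonneg hα0 hY0
  set s' := Icc (A - 2 * ε - (1 - α) * Y) (A - 2 * ε - α * Y) with hs'
  have hsub : s' ⊆ Icc (A - 2 * δ) A := by
    intro u hu
    rw [hs', Set.mem_Icc] at hu
    rw [Set.mem_Icc]
    constructor <;> linarith [hu.1, hu.2, hαY0, hY, hε0]
  have hlow : ∀ u ∈ s', m (α * Y) * m (α * Y) ≤ g (A - u) * g (u - (A - 2 * δ)) := by
    intro u hu
    rw [hs', Set.mem_Icc] at hu
    have hmem1 : A - u ∈ Set.Ici (2 * ε) := Set.mem_Ici.2 (by linarith [hu.2, hαY0])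
    have hmem2 : u - (A - 2 * δ) ∈ Set.Ici (2 * ε) := Set.mem_Ici.2 (by linarith [hu.1, hαY0, hY])
    simp only [hg]
    rw [indicator_of_mem hmem1, indicator_of_mem hmem2]
    refine mul_le_mul (hmmono hαY0 ?_) (hmmono hαY0 ?_) (hm0 _) (hm0 _)
    · linarith [hu.2]
    · linarith [hu.1, hY]
  have hnonneg : 0 ≤ᵐ[volume.restrict (Icc (A - 2 * δ) A)] fun u : ℝ => g (A - u) * g (u - (A - 2 * δ)) := by
    rw [Filter.EventuallyLE, ae_restrict_iff' measurableSet_Icc]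
    refine Filter.Eventually.of_forall fun u hu => ?_
    have h1 : A - u ∈ Icc 0 (2 * δ) := ⟨by linarith [hu.2], by linarith [hu.1]⟩
    have h2 : u - (A - 2 * δ) ∈ Icc 0 (2 * δ) := ⟨by linarith [hu.1], by linarith [hu.2]⟩
    exact mul_nonneg (hg0 _ h1) (hg0 _ h2)
  have hstep1 : ∫ u in s', g (A - u) * g (u - (A - 2 * δ)) ≤ ∫ u in Icc (A - 2 * δ) A, g (A - u) * g (u - (A - 2 * δ)) :=
    setIntegral_mono_set hgi hnonneg (Filter.Eventually.of_forall hsub)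
  have hstep2 : m (α * Y) * m (α * Y) * (volume : Measure ℝ).real s' ≤ ∫ u in s', g (A - u) * g (u - (A - 2 * δ)) :=
    setIntegral_ge_of_const_le_real measurableSet_Icc (by rw [hs', Real.volume_Icc]; exact ENNReal.ofReal_ne_top) hlow
      (hgi.mono_set hsub)
  have hvol : (volume : Measure ℝ).real s' = (1 - 2 * α) * Y := by
    have h : 0 ≤ (A - 2 * ε - α * Y) - (A - 2 * ε - (1 - α) * Y) := by linarith [hαY]
    rw [hs', Real.volume_real_Icc, max_eq_left h]
    ring
  rw [hvol] at hstep2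
  -- assemble
  have e : (1 - 2 * α) * (2 * δ - 4 * ε) * (κ' * dodgerPhi (p * (α * (2 * δ - 4 * ε)) ^ 2)) ^ 2 =
      m (α * Y) * m (α * Y) * ((1 - 2 * α) * Y) := by
    simp only [hm, hY]; ring
  rw [e]
  exact hstep2.trans (hstep1.trans hcollar)

/-! ## Monotonicity of the window gain and the witness -/

/-- The window gain bound `(1−2α)(2δ−4ε)·(κ·(c_∞/2b)·Φ(p₁(α(2δ−4ε))²))²` is non-decreasing in `δ` on `2ε ≤ δ`
(for `κ ≥ 0`, `b > 0`, `p₁ ≥ 0`, `0 ≤ α ≤ 1/2`). [this track, ATTEMPT-19 §7; ATTEMPT-23 §7] -/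
theorem windowGain_mono {b T ε κ α δ₁ δ₂ : ℝ} (hb : 0 < b) (hκ : 0 ≤ κ) (hp : 0 ≤ (dodgerPowerSum b T 1).re)
    (hα0 : 0 ≤ α) (hα : α ≤ 1 / 2) (hε : 2 * ε ≤ δ₁) (h : δ₁ ≤ δ₂) :
    (1 - 2 * α) * (2 * δ₁ - 4 * ε) *
      (κ * ((1 / (2 * b)) * ((∏ k ∈ Finset.range (zetaZeroCount T), (latticeFreq b (k + 1)) ^ 2) /
        ∏ ρ ∈ zerosBetween 0 T, ‖dodgerNode ρ‖ ^ (2 * (riemannZetaZeroOrder ρ).toNat))) *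
        dodgerPhi ((dodgerPowerSum b T 1).re * (α * (2 * δ₁ - 4 * ε)) ^ 2)) ^ 2 ≤
      (1 - 2 * α) * (2 * δ₂ - 4 * ε) *
        (κ * ((1 / (2 * b)) * ((∏ k ∈ Finset.range (zetaZeroCount T), (latticeFreq b (k + 1)) ^ 2) /
        ∏ ρ ∈ zerosBetween 0 T, ‖dodgerNode ρ‖ ^ (2 * (riemannZetaZeroOrder ρ).toNat))) *
          dodgerPhi ((dodgerPowerSum b T 1).re * (α * (2 * δ₂ - 4 * ε)) ^ 2)) ^ 2 := by
  have hc : 0 ≤ (1 / (2 * b)) * ((∏ k ∈ Finset.range (zetaZeroCount T), (latticeFreq b (k + 1)) ^ 2) /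
      ∏ ρ ∈ zerosBetween 0 T, ‖dodgerNode ρ‖ ^ (2 * (riemannZetaZeroOrder ρ).toNat)) := by
    have h1 : 0 < ∏ k ∈ Finset.range (zetaZeroCount T), (latticeFreq b (k + 1)) ^ 2 :=
      Finset.prod_pos fun k _ => by unfold latticeFreq; positivity
    have := prod_norm_dodgerNode_pow_pos T
    positivity
  have hY : 0 ≤ 2 * δ₁ - 4 * ε := by linarith
  have hΦ1 : 0 ≤ dodgerPhi ((dodgerPowerSum b T 1).re * (α * (2 * δ₁ - 4 * ε)) ^ 2) := (dodgerPhi_pos (by positivity)).le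
  have hΦ : dodgerPhi ((dodgerPowerSum b T 1).re * (α * (2 * δ₁ - 4 * ε)) ^ 2) ≤
      dodgerPhi ((dodgerPowerSum b T 1).re * (α * (2 * δ₂ - 4 * ε)) ^ 2) := by
    refine dodgerPhi_le_dodgerPhi (by positivity) (mul_le_mul_of_nonneg_left ?_ hp)
    exact pow_le_pow_left₀ (by positivity) (by nlinarith) 2
  have hA : 0 ≤ κ * ((1 / (2 * b)) * ((∏ k ∈ Finset.range (zetaZeroCount T), (latticeFreq b (k + 1)) ^ 2) /
      ∏ ρ ∈ zerosBetween 0 T, ‖dodgerNode ρ‖ ^ (2 * (riemannZetaZeroOrder ρ).toNat))) *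
      dodgerPhi ((dodgerPowerSum b T 1).re * (α * (2 * δ₁ - 4 * ε)) ^ 2) := by positivity
  have h12 : 0 ≤ 1 - 2 * α := by linarith
  refine mul_le_mul (mul_le_mul_of_nonneg_left (by linarith) h12)
    (pow_le_pow_left₀ hA (mul_le_mul_of_nonneg_left hΦ (mul_nonneg hκ hc)) 2)
    (pow_nonneg hA 2) (mul_nonneg h12 (by linarith))

/-- **THE DODGER WITNESS AT ONE PRIME with a free collar window** (gen10's `dodger_witness` verbatim, the comparison `hlt` stated with
the window gain `(1−2α)(2(δ−r)−4r)·(κ·(c_∞/2b)·Φ(p₁(α(2(δ−r)−4r))²))²`, `0 ≤ α ≤ 1/2`). [this track, ATTEMPT-16 §6; ATTEMPT-19 §7; ATTEMPT-23 §7] -/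
theorem dodger_witness_window {q q' : ℕ} {b T δ C α : ℝ} (n : ℕ) (hα0 : 0 ≤ α) (hα : α ≤ 1 / 2)
    (hbq1 : b + (bump n).rOut ≤ Real.log q / 2) (hbq2 : Real.log q / 2 ≤ b + 2 * (bump n).rOut)
    -- cost hypotheses (`dodger_cost_le`)
    (hb : 0 < b) (hT2 : 2 ≤ T) (hK1 : 1 ≤ zetaZeroCount T) (hK : π * (zetaZeroCount T) / b ≤ T)
    {D : ℝ → ℝ} (hD : ContinuousOn D (Set.Icc 0 T)) (hD0 : ∀ t ∈ Set.Icc 0 T, 0 ≤ D t)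
    (hΔ : ∀ t ∈ Set.Icc 0 T, (zetaZeroCount t : ℝ) - ((min ⌊b * t / π⌋₊ (zetaZeroCount T) : ℕ) : ℝ) ≤ -D t)
    (hc : 64 ≤ 4 * ∫ t in (0 : ℝ)..T, t * D t)
    (hgen : ∀ ρ : ℂ, riemannZeta ρ = 0 → 0 < ρ.im →
      ∀ k ∈ Finset.range (zetaZeroCount T), dodgerNode ρ - latticeFreq b (k + 1) ≠ 0)
    -- gain hypotheses (`dodger_collar_ge`)
    (hp : 0 < (dodgerPowerSum b T 1).re) (hδb : δ ≤ b) (hεδ : 3 * (bump n).rOut ≤ δ)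
    {N₁ N₂ : ℕ} (hN : N₁ ≤ N₂) (hWN : (T ^ 2 + 1 / 4) * N₂ ≤ (dodgerPowerSum b T 1).re / 2)
    {X η lam ρ₁ ρ₂ τ₁ τ₂ : ℝ} (hX : (dodgerPowerSum b T 1).re * (2 * δ) ^ 2 ≤ X)
    (hη : Real.exp (2 * ((dodgerPowerSum b T 1).re + (zetaZeroCount T : ℝ) * (T + 1 / 2)) * (T ^ 2 + 1 / 4) * (N₁ : ℝ) ^ 2 /
        (dodgerPowerSum b T 1).re ^ 2) - 1 ≤ η)
    (hlam : 2 * ((dodgerPowerSum b T 1).re + (zetaZeroCount T : ℝ) * (T + 1 / 2)) * (T ^ 2 + 1 / 4) * (N₂ : ℝ) /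
        (dodgerPowerSum b T 1).re ^ 2 ≤ lam)
    (hρ₁ : Real.exp (3 + lam) * X / (4 * ((N₁ : ℝ) + 1) ^ 3) ≤ ρ₁) (hρ₁1 : ρ₁ < 1)
    (hρ₂ : Real.exp 2 * (T ^ 2 + 1 / 4) * (2 * δ) ^ 2 / (2 * ((N₂ : ℝ) + 1) ^ 2) ≤ ρ₂) (hρ₂1 : ρ₂ < 1)
    (hτ₁ : ρ₁ ^ (N₁ + 1) / (1 - ρ₁) ≤ τ₁)
    (hτ₂ : Real.exp (((dodgerPowerSum b T 1).re + ((dodgerPowerSum b T 1).re + (zetaZeroCount T : ℝ) * (T + 1 / 2))) /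
        (2 * (T ^ 2 + 1 / 4))) * ρ₂ ^ (N₂ + 1) / (1 - ρ₂) ≤ τ₂)
    (hκ : 0 ≤ 1 - η - 3 * τ₁ - τ₂)
    -- the window
    (hδC : δ ≤ C * Real.log q ^ (3 / 2 : ℝ) * (q : ℝ) ^ (-(3 / 2 : ℝ))) (hwin : Real.log q / 2 + δ ≤ Real.log q' / 2)
    -- the one comparison
    (hlt : dodgerCostBound b T δ (4 * ∫ t in (0 : ℝ)..T, t * D t) <
      2 * Real.log q / Real.sqrt q *
        ((1 - 2 * α) * (2 * (δ - (bump n).rOut) - 4 * (bump n).rOut) *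
          ((1 - η - 3 * τ₁ - τ₂) * ((1 / (2 * b)) * ((∏ k ∈ Finset.range (zetaZeroCount T), (latticeFreq b (k + 1)) ^ 2) /
        ∏ ρ ∈ zerosBetween 0 T, ‖dodgerNode ρ‖ ^ (2 * (riemannZetaZeroOrder ρ).toNat))) *
            dodgerPhi ((dodgerPowerSum b T 1).re * (α * (2 * (δ - (bump n).rOut) - 4 * (bump n).rOut)) ^ 2)) ^ 2)) :
    ∃ θ : ℝ → ℂ, ∃ δ' B : ℝ, IsWeilTest θ ∧ tsupport θ ⊆ Icc (-(Real.log q / 2)) (Real.log q / 2) ∧ 0 ≤ δ' ∧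
      δ' ≤ C * Real.log q ^ (3 / 2 : ℝ) * (q : ℝ) ^ (-(3 / 2 : ℝ)) ∧ Real.log q / 2 + δ' ≤ Real.log q' / 2 ∧
      (∀ U : ℝ, ∑ᶠ ρ ∈ weilZeroIndex U,
          (riemannZetaZeroOrder ρ : ℝ) * ‖weilMellin (fun x ↦ θ (x - δ') - θ (x + δ')) ρ‖ ^ 2 ≤ B) ∧
      B < 2 * Real.log q / Real.sqrt q * (weilConv θ (weilReflect θ) (Real.log q - 2 * δ')).re := by
  set F₀ := cutoffCosPoly b (zetaZeroCount T) (dodgerCoeff b T (zetaZeroCount T)) with hF₀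
  set θ := weilConv F₀ (moll n) with hθdef
  set r := (bump n).rOut with hr
  have hr0 : 0 < r := (bump n).rOut_pos
  have hδ0 : 0 ≤ δ := by linarith
  have hFi : Integrable F₀ := integrable_cutoffCosPoly b _ _
  have hFs : HasCompactSupport F₀ :=
    HasCompactSupport.of_support_subset_isCompact (isCompact_Icc (a := -b) (b := b)) fun t ht => by
      have h : |t| ≤ b := le_of_not_gt fun h' => (Function.mem_support.1 ht) (cutoffCosPoly_eq_zero_of_lt h')
      exact Set.mem_Icc.2 (abs_le.1 h)
  have hθ : IsWeilTest θ := isWeilTest_weilConv_of_locallyIntegrable hFi.locallyIntegrable hFs (isWeilTest_moll n)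
  refine ⟨θ, δ, dodgerCostBound b T δ (4 * ∫ t in (0 : ℝ)..T, t * D t), hθ, ?_, hδ0, hδC, hwin, ?_, ?_⟩
  · -- support in the `q`-subwindow
    exact (tsupport_dodgerWitness_subset b T n).trans (Icc_subset_Icc (by linarith) hbq1)
  · -- the cost (explicit-formula side)
    intro U
    have h := dodger_cost_le hb hT2 hK1 hK hD hD0 hΔ hc hδ0 n hgen U
    exact h
  · -- the gain (collar side), at the shifted collar width `δ_g = δ − ((log q)/2 − b − r) ∈ [δ − r, δ]`
    set δg := δ - (Real.log q / 2 - (b + r)) with hδg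
    have hδg1 : δ - r ≤ δg := by rw [hδg]; linarith
    have hδg2 : δg ≤ δ := by rw [hδg]; linarith
    have hδg0 : 0 ≤ δg := by linarith
    have hΔ0 : ∀ t ∈ Set.Icc 0 T, (zetaZeroCount t : ℝ) - ((min ⌊b * t / π⌋₊ (zetaZeroCount T) : ℕ) : ℝ) ≤ 0 :=
      fun t ht => (hΔ t ht).trans (by linarith [hD0 t ht])
    have hsq : (2 * δg) ^ 2 ≤ (2 * δ) ^ 2 := pow_le_pow_left₀ (by linarith) (by linarith) 2
    have hXg : (dodgerPowerSum b T 1).re * (2 * δg) ^ 2 ≤ X := le_trans (mul_le_mul_of_nonneg_left hsq hp.le) hX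
    have hρ₂g : Real.exp 2 * (T ^ 2 + 1 / 4) * (2 * δg) ^ 2 / (2 * ((N₂ : ℝ) + 1) ^ 2) ≤ ρ₂ := by
      refine le_trans ?_ hρ₂
      gcongr
    have hgain := dodger_collar_ge_window n hα0 hα hb (by linarith) hK hΔ0 hp (hδg2.trans hδb) (by linarith) hN hWN hXg hη hlam
      hρ₁ hρ₁1 hρ₂g hρ₂1 hτ₁ hτ₂ hκ
    have hmono := windowGain_mono (T := T) (ε := r) (κ := 1 - η - 3 * τ₁ - τ₂) (α := α) hb hκ hp.le hα0 hα
      (by linarith) hδg1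
    have hlag : Real.log q - 2 * δ = 2 * (b + r) - 2 * δg := by rw [hδg]; ring
    rw [hlag]
    have hlog : 0 ≤ Real.log q := by linarith
    have hfac : 0 ≤ 2 * Real.log q / Real.sqrt q := by positivity
    calc dodgerCostBound b T δ (4 * ∫ t in (0 : ℝ)..T, t * D t)
        < 2 * Real.log q / Real.sqrt q *
          ((1 - 2 * α) * (2 * (δ - r) - 4 * r) *
            ((1 - η - 3 * τ₁ - τ₂) * ((1 / (2 * b)) * ((∏ k ∈ Finset.range (zetaZeroCount T), (latticeFreq b (k + 1)) ^ 2) /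
        ∏ ρ ∈ zerosBetween 0 T, ‖dodgerNode ρ‖ ^ (2 * (riemannZetaZeroOrder ρ).toNat))) *
              dodgerPhi ((dodgerPowerSum b T 1).re * (α * (2 * (δ - r) - 4 * r)) ^ 2)) ^ 2) := hlt
      _ ≤ 2 * Real.log q / Real.sqrt q *
          ((1 - 2 * α) * (2 * δg - 4 * r) *
            ((1 - η - 3 * τ₁ - τ₂) * ((1 / (2 * b)) * ((∏ k ∈ Finset.range (zetaZeroCount T), (latticeFreq b (k + 1)) ^ 2) /
        ∏ ρ ∈ zerosBetween 0 T, ‖dodgerNode ρ‖ ^ (2 * (riemannZetaZeroOrder ρ).toNat))) *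
              dodgerPhi ((dodgerPowerSum b T 1).re * (α * (2 * δg - 4 * r)) ^ 2)) ^ 2) :=
          mul_le_mul_of_nonneg_left hmono hfac
      _ ≤ 2 * Real.log q / Real.sqrt q * (weilConv θ (weilReflect θ) (2 * (b + r) - 2 * δg)).re :=
          mul_le_mul_of_nonneg_left hgain hfac

end Summit.RiemannHypothesis.RiemannHypothesis.Theorems.Handoff

end
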